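/-
Copyright (c) 2026 the pub-hodgecm-mathlib formalisation cell (harness21).  Prover seat hodgecm-mathlib-K2Liu-p02 (g7), Track B «K2-LIT» ∕ hLiu418
#184♮, socket #41 open surface (u-0c) `K2LiuSiegelEisensteinMiddleTermPackageInstance` (LEAD F0P6-plan (g14) BATCH #49 (4)), file I1 letter, torus case.
THEOREMS ONLY (no `def`, no `instance`, no notation, no named-fact hypothesis, no `sorry`).
-/
import Summits.HodgeConjecture.HodgeConjecture.Theorems.K2LiuReflStdLeviConjDeltaBlock   -- `deltaBlock_reflStd_conj_levi` (the `Δ`-block of `w₀ Λ(x) w₀`)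
import HarnessLib

/-!
# Crux `HLiu418`, Road Φ, organ G5-a ∕ (u-0c) file I1 letter, TORUS CASE: `det_Δ (w₀ · Λ(diag(d₀, d₁)) · w₀) = d₀ · d̄₁⁻¹`

Cell `hodgecm-mathlib`, crux item hLiu418 = `stmt-HodgeConjecture-24832`; squad K2 ∕ K2Liu, prover K2Liu-p02 (g7); count-neutral helper.
Namespace `Summit.HodgeConjecture.HodgeConjecture.Cruxes.HLiu418.K2LiuReflStdTorusConjDetDelta`.

For the diagonal torus `x = diag(d₀, d₁) ∈ GL₂(𝔸_L)` and a DIAGONAL Gram matrix `T_𝔸 = diag(t)` (★ α2d `exists_gramR_eq_diagonal`; by value as `hT`, `ht`), the dual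
Levi block is `x♯ = T⁻¹ (x̄⁻¹)ᵀ T = diag(d̄₀⁻¹, d̄₁⁻¹)` (`sharp_of_diagonal`), so ★ `deltaBlock_reflStd_conj_levi` reads
**`deltaBlock (w₀ Λ(x) w₀) = diag(d₀, d̄₁⁻¹)`** and **`det_Δ (w₀ Λ(x) w₀) = d₀ · d̄₁⁻¹`** — the value the torus law of the inner section of the middle cell needs
(`σ_s(w₀Λ(diag d)w₀) = χ(d₀ d̄₁⁻¹)·|d₀ d̄₁⁻¹|^{s+1}`, CENSUS-41 §8 «`(s+1, −s)`»; ★ (β0-1b) `inner_law_of_unfold`, `untwist_torus_law`).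
[MoeglinWaldspurger1995, II.1.7; KudlaRallis1994, §2 (2.10)–(2.12).]

HONEST LABEL.  Count-neutral helper: `HC_CM` is proved only modulo the 7 printed citations (2 remaining named inputs: hLiu418 = `stmt-HodgeConjecture-24832`,
h413 = `stmt-HodgeConjecture-24833`) until rung 0 closes; closes no socket by itself.
-/

set_option autoImplicit false
set_option linter.dupNamespace false -- the mandated namespace repeats `HodgeConjecture.HodgeConjecture`

noncomputable section

open scoped Matrix
open NumberField IsDedekindDomain
open Literature.NumberTheory.Automorphic Literature.NumberTheory.Automorphic.UnitaryGroup Literature.NumberTheory.GaloisRepresentations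
open Literature.NumberTheory.GelbartRogawski1991 Literature.NumberTheory.GelbartRogawski1991.GRConstruction
open Literature.NumberTheory.K2Lit.SiegelDoubled
open Literature.NumberTheory.GelbartRogawski1991.AdaptedBlocks
open UnitaryDualPair
open Summit.HodgeConjecture.HodgeConjecture.Cruxes.HLiu418.K2LiuReflStdLeviConjDeltaBlock (deltaBlock_reflStd_conj_levi)

namespace Summit.HodgeConjecture.HodgeConjecture.Cruxes.HLiu418.K2LiuReflStdTorusConjDetDelta

/-! ## §1 The dual Levi block of a diagonal torus element for a diagonal Gram matrix -/

section Sharp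

variable {R : Type*} [CommRing R]

/-- `T⁻¹ · (diag(d)⁻¹ mapped by σ)ᵀ · T = diag(σ(d⁻¹))` for `T = diag(t)` with unit entries. [folklore] -/
theorem inv_mul_transpose_map_inv_mul_of_diagonal (σ : R →+* R) (d : Fin 2 → Rˣ) (x : GL (Fin 2) R)
    (hx : (x : Matrix (Fin 2) (Fin 2) R) = Matrix.diagonal fun i => (d i : R)) (T : Matrix (Fin 2) (Fin 2) R) (t : Fin 2 → R)
    (hT : T = Matrix.diagonal t) (ht : ∀ i, IsUnit (t i)) :
    T⁻¹ * ((((x⁻¹ : GL (Fin 2) R)) : Matrix (Fin 2) (Fin 2) R).map σ)ᵀ * T = Matrix.diagonal fun i => σ (((d i)⁻¹ : Rˣ) : R) := by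
  -- `x⁻¹ = diag(d⁻¹)` and `T⁻¹ = diag(t⁻¹)` by uniqueness of the inverse (`Matrix.inv_eq_left_inv`)
  have hxinv : (((x⁻¹ : GL (Fin 2) R)) : Matrix (Fin 2) (Fin 2) R) = Matrix.diagonal fun i => (((d i)⁻¹ : Rˣ) : R) := by
    rw [Matrix.coe_units_inv, hx]
    refine Matrix.inv_eq_left_inv ?_
    rw [Matrix.diagonal_mul_diagonal, ← Matrix.diagonal_one]
    congr 1
    funext i
    exact (d i).inv_mul
  have hTinv : T⁻¹ = Matrix.diagonal fun i => Ring.inverse (t i) := by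
    rw [hT]
    refine Matrix.inv_eq_left_inv ?_
    rw [Matrix.diagonal_mul_diagonal, ← Matrix.diagonal_one]
    congr 1
    funext i
    exact Ring.inverse_mul_cancel _ (ht i)
  rw [hTinv, hxinv, Matrix.diagonal_map (map_zero σ), Matrix.diagonal_transpose, hT, Matrix.diagonal_mul_diagonal, Matrix.diagonal_mul_diagonal]
  congr 1
  funext i
  rw [mul_right_comm, Ring.inverse_mul_cancel _ (ht i), one_mul]

end Sharp

/-! ## §2 The torus case at the K2Liu datum -/

section Doubled

variable (L : Type) [Field L] [NumberField L] [IsCMField L]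
variable {N M : ℕ} (e : Fin N × Fin M ≃ Fin 2)
  (dV : Fin N → L) (hdV : ∀ i, IsCMField.complexConj L (dV i) = dV i)
  (dW : Fin M → L) (hdW : ∀ i, IsCMField.complexConj L (dW i) = dW i)

variable {g₀ : UnitaryGroup.rationalPair (Fp L) L (IsCMField.complexConj L) N M (Matrix.diagonal dV) (Matrix.diagonal dW)}
  (hg₀ : ((g₀ : GL (Fin N × Fin M) L) : Matrix (Fin N × Fin M) (Fin N × Fin M) L) = Matrix.diagonal (fun k => 1 - 2 * (![0, 1] : Fin 2 → L) (e k)))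

variable (Λ : GL (Fin 2) (AdeleRing (𝓞 L) L) →* HA L e dV hdV dW hdW)
  (hΛ : ∀ g : GL (Fin 2) (AdeleRing (𝓞 L) L), blk L e dV hdV dW hdW (Λ g) =
    cayR (AdeleRing (𝓞 L) L) (Fin 2) * Matrix.fromBlocks (g : Matrix (Fin 2) (Fin 2) (AdeleRing (𝓞 L) L)) 0 0
      (((gramR L e dV hdV dW hdW).map ((algebraMap L (AdeleRing (𝓞 L) L)).comp (algebraMap (Fp L) L)))⁻¹ *
        (((g⁻¹ : GL (Fin 2) (AdeleRing (𝓞 L) L)) : Matrix (Fin 2) (Fin 2) (AdeleRing (𝓞 L) L)).map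
          (conjAdele (Fp L) L (IsCMField.complexConj L)))ᵀ *
        (gramR L e dV hdV dW hdW).map ((algebraMap L (AdeleRing (𝓞 L) L)).comp (algebraMap (Fp L) L))) *
      cayRinv (AdeleRing (𝓞 L) L) (Fin 2))

include hg₀ hΛ in
/-- **THE `Δ`-BLOCK OF `w₀ · Λ(diag(d₀,d₁)) · w₀` IS `diag(d₀, d̄₁⁻¹)`** (diagonal Gram matrix `T_𝔸 = diag(t)`, unit entries, by value).
[cite: MoeglinWaldspurger1995, II.1.7] [cite: KudlaRallis1994, §2 (2.10)–(2.12)] -/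
theorem deltaBlock_reflStd_conj_torus (d : Fin 2 → (AdeleRing (𝓞 L) L)ˣ) (x : GL (Fin 2) (AdeleRing (𝓞 L) L))
    (hx : (x : Matrix (Fin 2) (Fin 2) (AdeleRing (𝓞 L) L)) = Matrix.diagonal fun i => (d i : AdeleRing (𝓞 L) L))
    (t : Fin 2 → AdeleRing (𝓞 L) L) (hT : (gramR L e dV hdV dW hdW).map ((algebraMap L (AdeleRing (𝓞 L) L)).comp (algebraMap (Fp L) L)) = Matrix.diagonal t)
    (ht : ∀ i, IsUnit (t i)) :
    deltaBlock L e dV hdV dW hdW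
        (iotaGG L e dV hdV dW hdW (1, UnitaryGroup.rationalPairToAdelic (Fp L) L (IsCMField.complexConj L) N M (Matrix.diagonal dV) (Matrix.diagonal dW) g₀) *
          Λ x *
          iotaGG L e dV hdV dW hdW (1, UnitaryGroup.rationalPairToAdelic (Fp L) L (IsCMField.complexConj L) N M (Matrix.diagonal dV) (Matrix.diagonal dW) g₀)) =
      Matrix.diagonal ![(d 0 : AdeleRing (𝓞 L) L), conjAdele (Fp L) L (IsCMField.complexConj L) (((d 1)⁻¹ : (AdeleRing (𝓞 L) L)ˣ) : AdeleRing (𝓞 L) L)] := by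
  rw [deltaBlock_reflStd_conj_levi L e dV hdV dW hdW hg₀ Λ hΛ x,
    inv_mul_transpose_map_inv_mul_of_diagonal (conjAdele (Fp L) L (IsCMField.complexConj L)) d x hx _ t hT ht, hx]
  ext i j
  fin_cases i <;> fin_cases j <;> simp

include hg₀ hΛ in
/-- **`det_Δ (w₀ · Λ(diag(d₀,d₁)) · w₀) = d₀ · d̄₁⁻¹`.** [cite: MoeglinWaldspurger1995, II.1.7] [cite: KudlaRallis1994, §2 (2.10)–(2.12)] -/
theorem detDelta_reflStd_conj_torus (d : Fin 2 → (AdeleRing (𝓞 L) L)ˣ) (x : GL (Fin 2) (AdeleRing (𝓞 L) L))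
    (hx : (x : Matrix (Fin 2) (Fin 2) (AdeleRing (𝓞 L) L)) = Matrix.diagonal fun i => (d i : AdeleRing (𝓞 L) L))
    (t : Fin 2 → AdeleRing (𝓞 L) L) (hT : (gramR L e dV hdV dW hdW).map ((algebraMap L (AdeleRing (𝓞 L) L)).comp (algebraMap (Fp L) L)) = Matrix.diagonal t)
    (ht : ∀ i, IsUnit (t i)) :
    detDelta L e dV hdV dW hdW
        (iotaGG L e dV hdV dW hdW (1, UnitaryGroup.rationalPairToAdelic (Fp L) L (IsCMField.complexConj L) N M (Matrix.diagonal dV) (Matrix.diagonal dW) g₀) *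
          Λ x *
          iotaGG L e dV hdV dW hdW (1, UnitaryGroup.rationalPairToAdelic (Fp L) L (IsCMField.complexConj L) N M (Matrix.diagonal dV) (Matrix.diagonal dW) g₀)) =
      (d 0 : AdeleRing (𝓞 L) L) * conjAdele (Fp L) L (IsCMField.complexConj L) (((d 1)⁻¹ : (AdeleRing (𝓞 L) L)ˣ) : AdeleRing (𝓞 L) L) := by
  unfold detDelta
  rw [deltaBlock_reflStd_conj_torus L e dV hdV dW hdW hg₀ Λ hΛ d x hx t hT ht, Matrix.det_diagonal, Fin.prod_univ_two]
  rfl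

include hg₀ hΛ in
/-- **… and it is a UNIT** (so `w₀ Λ(diag d) w₀ ∈ P_Δ(𝔸)` carries the inducing character `χ(d₀ d̄₁⁻¹)·|d₀ d̄₁⁻¹|^{s+n∕2}`).
[cite: MoeglinWaldspurger1995, II.1.7] -/
theorem isUnit_detDelta_reflStd_conj_torus (d : Fin 2 → (AdeleRing (𝓞 L) L)ˣ) (x : GL (Fin 2) (AdeleRing (𝓞 L) L))
    (hx : (x : Matrix (Fin 2) (Fin 2) (AdeleRing (𝓞 L) L)) = Matrix.diagonal fun i => (d i : AdeleRing (𝓞 L) L))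
    (t : Fin 2 → AdeleRing (𝓞 L) L) (hT : (gramR L e dV hdV dW hdW).map ((algebraMap L (AdeleRing (𝓞 L) L)).comp (algebraMap (Fp L) L)) = Matrix.diagonal t)
    (ht : ∀ i, IsUnit (t i)) :
    IsUnit (detDelta L e dV hdV dW hdW
        (iotaGG L e dV hdV dW hdW (1, UnitaryGroup.rationalPairToAdelic (Fp L) L (IsCMField.complexConj L) N M (Matrix.diagonal dV) (Matrix.diagonal dW) g₀) *
          Λ x *
          iotaGG L e dV hdV dW hdW (1, UnitaryGroup.rationalPairToAdelic (Fp L) L (IsCMField.complexConj L) N M (Matrix.diagonal dV) (Matrix.diagonal dW) g₀))) := by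
  rw [detDelta_reflStd_conj_torus L e dV hdV dW hdW hg₀ Λ hΛ d x hx t hT ht]
  exact (d 0).isUnit.mul (((d 1)⁻¹).isUnit.map _)

end Doubled

end Summit.HodgeConjecture.HodgeConjecture.Cruxes.HLiu418.K2LiuReflStdTorusConjDetDelta

end
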